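import Literature.Dynamics.Ergodic.ToralGeneratorsFullMeasure
import Literature.AlgebraicGeometry.HodgeTheory.AbelianVarietyTranslationsMinimality
import HarnessLib

/-!
# A complex abelian variety `A(ℂ)` is a monothetic group; Haar-almost every translation of `A(ℂ)` is ergodic
# and minimal (Gottschalk–Hedlund 4.49–4.53; Cornfeld–Fomin–Sinai Ch. 3 §1 Theorem 1 / Kronecker)

Lane `lit-hodgefound`, row A1-30⁺⁵⁹ / (A1-30⁺²⁷)⁺ (prover seat `lit-hodgefound-p31`): the lane file of
`Literature/Dynamics/Ergodic/ToralGeneratorsFullMeasure.lean` (Haar-almost every point of `(ℝ/ℤ)^d` generates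
a dense cyclic subgroup; `(ℝ/ℤ)^d` is monothetic), read on the tree's complex tori `X = E/Φ(ℤ^ι)` and — through a
uniformising group-homeomorphism `φ : X ≃ A(ℂ)` with `μ = φ_* vol` (rows A1-30⁺²⁵/⁺²⁷) — on the compact connected
commutative metrisable group `A(ℂ)` of a complex abelian variety `A` with its Haar probability measure `μ`.

Printed statements.  W. H. Gottschalk, G. A. Hedlund, *Topological Dynamics* (1955; held
`book:gottschalk1955-topological-dynamics`, chunk p0053): **4.49** (monothetic groups), **4.50 (2)** «`G` is
monothetic if and only if there exists `x ∈ G` such that `[xⁿ | n ∈ ℤ]` is dense in `G`», **4.53 Remark** «Let `G`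
be a compact connected separable abelian group. Then `G` is monothetic.»; I. P. Cornfeld, S. V. Fomin,
Ya. G. Sinai, *Ergodic Theory*, Ch. 3 §1 Theorem 1 / Lemma 1 (held chunks p0100–p0101: the translation by `α` is
ergodic, resp. has dense orbits, iff `1, α_1, …, α_m` are rationally independent).  Row A1-30⁺²⁷ proved, for EACH
`Q ∈ A(ℂ)`, `P ↦ P·Q` ergodic ⟺ `{Qⁿ}` dense (`AbelianVariety.ergodic_mul_right_iff_denseRange_zpow`); this file
says for HOW MANY `Q` this holds: for `μ`-almost every `Q` (a dense set of full Haar measure), in particular for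
some `Q` — `A(ℂ)` IS MONOTHETIC (4.53 for `G = A(ℂ)`).

## Contents (theorems only; no definition, no named fact, net debt 0)

§1 `ComplexTorus.ae_denseRange_zsmul`, `ComplexTorus.ae_ergodic_add_right`, `ComplexTorus.exists_denseRange_zsmul`
(the complex torus is monothetic), `ComplexTorus.dense_setOf_denseRange_zsmul`.
§2 **`AbelianVariety.exists_denseRange_zpow`** (4.53: `A(ℂ)` IS MONOTHETIC — some `Q ∈ A(ℂ)` has `{Qⁿ : n ∈ ℤ}`
dense), **`AbelianVariety.ae_denseRange_zpow`** (μ-a.e. `Q` generates), **`AbelianVariety.ae_ergodic_mul_right`**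
(μ-a.e. translation `P ↦ P·Q` is ergodic), `AbelianVariety.ae_forall_dense_range_mul_zpow` (μ-a.e. translation
is minimal: EVERY orbit `{P·Qⁿ}` dense), `AbelianVariety.dense_setOf_denseRange_zpow` (the generators are dense
in `A(ℂ)`), `AbelianVariety.exists_ergodic_mul_right`.

## References

* [GottschalkHedlund1955] W. H. Gottschalk, G. A. Hedlund, *Topological Dynamics*, AMS Colloquium Publications 36
  (1955), 4.49, 4.50, 4.53 (held text chunk p0053).
* [CornfeldFominSinai1982] I. P. Cornfeld, S. V. Fomin, Ya. G. Sinai, *Ergodic Theory*, Grundlehren 245 (1982),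
  Ch. 3 §1 Theorem 1, Lemma 1 (held text chunks p0100–p0101).
* [Walters1982] P. Walters, *An Introduction to Ergodic Theory*, GTM 79 (1982), §1.5 Theorem 1.9, §5.2 Theorem
  5.4 (held text chunks p0042, p0132).
-/

noncomputable section

-- `ComplexTorus Φ` (for `Φ : ℝ^ι ≃ E`) is the type `ι → ℝ/ℤ = UnitAddTorus ι`; instance paths up to unfolding
set_option backward.isDefEq.respectTransparency false

open scoped Topology
open Function MeasureTheory MeasureTheory.Measure Set Filter
open Literature.Dynamics.Ergodic
open Literature.AlgebraicGeometry.Motives (ComplexPoints AbelianVariety)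

/-! ### §1 The complex torus `X = E/Φ(ℤ^ι)` -/

namespace Literature.Geometry.Kaehler.ComplexTorus

variable {ι : Type*} [Fintype ι] {E : Type*} [NormedAddCommGroup E] [NormedSpace ℂ E] (Φ : (ι → ℝ) ≃L[ℝ] E)

/-- **Haar-almost every point of a complex torus generates it**: for `vol`-a.e. `a ∈ X = E/Φ(ℤ^ι)` the cyclic
group `ℤa` is dense. [cite: GottschalkHedlund1955, 4.53 (held text chunk p0053)]
[cite: CornfeldFominSinai1982, Ch. 3 §1 Theorem 1, Lemma 1 (held text chunks p0100–p0101)] -/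
theorem ae_denseRange_zsmul : ∀ᵐ a : ComplexTorus Φ, DenseRange fun n : ℤ ↦ n • a :=
  ToralTranslation.ae_denseRange_zsmul (d := ι)

/-- **Haar-almost every translation `y ↦ y + a` of a complex torus is ergodic.**
[cite: CornfeldFominSinai1982, Ch. 3 §1 Theorem 1 (held text chunk p0100)] [cite: Walters1982, §1.5 Theorem 1.9 (held text chunk p0042)] -/
theorem ae_ergodic_add_right : ∀ᵐ a : ComplexTorus Φ, Ergodic (fun y : ComplexTorus Φ ↦ y + a) volume :=
  ToralTranslation.ae_ergodic_add_right (d := ι)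

/-- **A complex torus is monothetic** (Gottschalk–Hedlund 4.53): some `a ∈ X` has `ℤa` dense.
[cite: GottschalkHedlund1955, 4.49, 4.50 (2), 4.53 (held text chunk p0053)] -/
theorem exists_denseRange_zsmul : ∃ a : ComplexTorus Φ, DenseRange fun n : ℤ ↦ n • a :=
  ToralTranslation.exists_denseRange_zsmul (d := ι)

/-- The generators of a complex torus are dense. [cite: GottschalkHedlund1955, 4.53 (held text chunk p0053)] -/
theorem dense_setOf_denseRange_zsmul : Dense {a : ComplexTorus Φ | DenseRange fun n : ℤ ↦ n • a} :=
  ToralTranslation.dense_setOf_denseRange_zsmul (d := ι)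

end Literature.Geometry.Kaehler.ComplexTorus

/-! ### §2 Complex abelian varieties -/

namespace Literature.AlgebraicGeometry.HodgeTheory

open Literature.Geometry.Kaehler

section Monothetic

variable (A : AbelianVariety ℂ)

/-- A uniformising group isomorphism `φ : X ≃ A(ℂ)` sends multiples to powers: `φ(n • t) = φ(t)ⁿ`. [folklore] -/
private theorem map_zsmul_eq_pow' {ι : Type} [Fintype ι] {E : Type} [NormedAddCommGroup E] [NormedSpace ℂ E]
    {Φ : (ι → ℝ) ≃L[ℝ] E} {φ : ComplexTorus Φ → ComplexPoints A.X} (hadd : ∀ x y, φ (x + y) = φ x * φ y)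
    (n : ℤ) (t : ComplexTorus Φ) : φ (n • t) = (φ t : A.Points ℂ) ^ n := by
  have h0 : φ 0 = 1 := by
    have h := hadd 0 0
    rw [add_zero] at h
    exact mul_left_cancel (h.symm.trans (mul_one _).symm)
  let Ψ : ComplexTorus Φ →+ Additive (A.Points ℂ) :=
    { toFun := fun t ↦ Additive.ofMul (φ t)
      map_zero' := by simp only [h0, ofMul_one]
      map_add' := fun x y ↦ by simp only [hadd, ofMul_mul] }
  have h := map_zsmul Ψ n t
  change Additive.ofMul (φ (n • t)) = n • Additive.ofMul (φ t) at h
  rw [← ofMul_zpow] at h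
  exact Additive.ofMul.injective h

/-- **Gottschalk–Hedlund 4.53 for a complex abelian variety: the compact connected abelian group `A(ℂ)` is
MONOTHETIC** — there is `Q ∈ A(ℂ)` with `{Qⁿ : n ∈ ℤ}` dense in `A(ℂ)` (4.50 (2)); equivalently `A(ℂ)` carries an
ergodic (row A1-30⁺²⁷), minimal and uniquely ergodic (rows A1-30⁺³²/⁺³³) translation.
[cite: GottschalkHedlund1955, 4.49, 4.50 (2), 4.53 (held text chunk p0053)] -/
theorem AbelianVariety.exists_denseRange_zpow : ∃ Q : A.Points ℂ, DenseRange fun n : ℤ ↦ Q ^ n := by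
  obtain ⟨ι, _, _, Φ, φ, hφ, hadd⟩ := complexAbelianVariety_torusUniformised_holds A
  obtain ⟨a, ha⟩ := ComplexTorus.exists_denseRange_zsmul Φ
  refine ⟨φ a, ?_⟩
  have hpow : (fun n : ℤ ↦ (φ a : A.Points ℂ) ^ n) = φ ∘ fun n : ℤ ↦ n • a := by
    funext n
    rw [Function.comp_apply, map_zsmul_eq_pow' A hadd]
  rw [hpow]
  exact hφ.isHomeomorph.surjective.denseRange.comp ha hφ.isHomeomorph.continuous

/-- **The generators of `A(ℂ)` are dense**: the set of `Q ∈ A(ℂ)` with `{Qⁿ}` dense is dense in `A(ℂ)`.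
[cite: GottschalkHedlund1955, 4.53 (held text chunk p0053)] [cite: CornfeldFominSinai1982, Ch. 3 §1 Lemma 1 (held text chunks p0100–p0101)] -/
theorem AbelianVariety.dense_setOf_denseRange_zpow :
    Dense {Q : A.Points ℂ | DenseRange fun n : ℤ ↦ Q ^ n} := by
  obtain ⟨ι, _, _, Φ, φ, hφ, hadd⟩ := complexAbelianVariety_torusUniformised_holds A
  have himage : φ '' {a : ComplexTorus Φ | DenseRange fun n : ℤ ↦ n • a} ⊆
      {Q : A.Points ℂ | DenseRange fun n : ℤ ↦ Q ^ n} := by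
    rintro _ ⟨a, ha, rfl⟩
    have hpow : (fun n : ℤ ↦ (φ a : A.Points ℂ) ^ n) = φ ∘ fun n : ℤ ↦ n • a := by
      funext n
      rw [Function.comp_apply, map_zsmul_eq_pow' A hadd]
    show DenseRange fun n : ℤ ↦ (φ a : A.Points ℂ) ^ n
    rw [hpow]
    exact hφ.isHomeomorph.surjective.denseRange.comp ha hφ.isHomeomorph.continuous
  exact (hφ.isHomeomorph.surjective.denseRange.dense_image hφ.isHomeomorph.continuous
    (ComplexTorus.dense_setOf_denseRange_zsmul Φ)).mono himage

variable [MeasurableSpace (ComplexPoints A.X)] [BorelSpace (ComplexPoints A.X)]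
  (μ : Measure (ComplexPoints A.X)) [IsProbabilityMeasure μ]
  (hμ : ∀ Q : A.Points ℂ, Measure.map (fun P : A.Points ℂ ↦ P * Q) μ = μ)

include hμ in
/-- **Haar-almost every element of `A(ℂ)` is a generator**: for `μ`-a.e. `Q ∈ A(ℂ)` (`μ` the translation-invariant
Borel probability measure) the powers `{Qⁿ : n ∈ ℤ}` are dense — transported from the uniformising torus
(`μ = φ_* vol`), where the non-generators lie in the countable union of the Haar-null rational hyperplanes of
Cornfeld–Fomin–Sinai's criterion. [cite: GottschalkHedlund1955, 4.53 (held text chunk p0053)]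
[cite: CornfeldFominSinai1982, Ch. 3 §1 Theorem 1, Lemma 1 (held text chunks p0100–p0101)] -/
theorem AbelianVariety.ae_denseRange_zpow : ∀ᵐ Q ∂μ, DenseRange fun n : ℤ ↦ (Q : A.Points ℂ) ^ n := by
  obtain ⟨ι, _, _, Φ, φ, hφ, hadd⟩ := complexAbelianVariety_torusUniformised_holds A
  have hμφ := eq_map_volume_of_map_mul_right_eq A hφ hadd μ hμ
  set e := hφ.homeomorph.toMeasurableEquiv with he
  have hecoe : (e : ComplexTorus Φ → ComplexPoints A.X) = φ := by
    rw [he, Homeomorph.toMeasurableEquiv_coe, hφ.coe_homeomorph]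
  rw [hμφ, ← hecoe, e.measurableEmbedding.ae_map_iff]
  refine (ComplexTorus.ae_denseRange_zsmul Φ).mono fun a ha ↦ ?_
  have hpow : (fun n : ℤ ↦ (e a : A.Points ℂ) ^ n) = φ ∘ fun n : ℤ ↦ n • a := by
    funext n
    rw [Function.comp_apply, hecoe, map_zsmul_eq_pow' A hadd]
  rw [hpow]
  exact hφ.isHomeomorph.surjective.denseRange.comp ha hφ.isHomeomorph.continuous

include hμ in
/-- **Haar-almost every translation of `A(ℂ)` is ergodic**: for `μ`-a.e. `Q`, `P ↦ P·Q` is ergodic for `μ`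
(Theorem 1 of Cornfeld–Fomin–Sinai for a.e. vector, through Walters' Theorem 1.9 on `A(ℂ)`, row A1-30⁺²⁷).
[cite: CornfeldFominSinai1982, Ch. 3 §1 Theorem 1 (held text chunk p0100)] [cite: Walters1982, §1.5 Theorem 1.9 (held text chunk p0042)] -/
theorem AbelianVariety.ae_ergodic_mul_right : ∀ᵐ Q ∂μ, Ergodic (fun P : A.Points ℂ ↦ P * Q) μ :=
  (AbelianVariety.ae_denseRange_zpow A μ hμ).mono fun Q hQ ↦
    (AbelianVariety.ergodic_mul_right_iff_denseRange_zpow A μ hμ Q).2 hQ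

include hμ in
/-- **Haar-almost every translation of `A(ℂ)` is minimal**: for `μ`-a.e. `Q`, EVERY orbit `{P·Qⁿ : n ∈ ℤ}` is dense
in `A(ℂ)` (Walters' Theorem 5.4 on `A(ℂ)`, row A1-30⁺³³). [cite: Walters1982, §5.2 Theorem 5.4 (held text chunk p0132)]
[cite: GottschalkHedlund1955, 4.53 (held text chunk p0053)] -/
theorem AbelianVariety.ae_forall_dense_range_mul_zpow :
    ∀ᵐ Q ∂μ, ∀ P : A.Points ℂ, Dense (Set.range fun n : ℤ ↦ P * Q ^ n) :=
  (AbelianVariety.ae_denseRange_zpow A μ hμ).mono fun Q hQ ↦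
    (AbelianVariety.forall_dense_range_mul_zpow_iff A Q).2 hQ

include hμ in
/-- The non-generators of `A(ℂ)` are `μ`-null. [cite: GottschalkHedlund1955, 4.53 (held text chunk p0053)]
[cite: CornfeldFominSinai1982, Ch. 3 §1 Theorem 1, Lemma 1 (held text chunks p0100–p0101)] -/
theorem AbelianVariety.measure_setOf_not_denseRange_zpow :
    μ {Q : A.Points ℂ | ¬DenseRange fun n : ℤ ↦ Q ^ n} = 0 := by
  have h := AbelianVariety.ae_denseRange_zpow A μ hμ
  rwa [ae_iff] at h

include hμ in
/-- **`A(ℂ)` carries an ergodic translation** (for its Haar probability measure).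
[cite: GottschalkHedlund1955, 4.53 (held text chunk p0053)] [cite: Walters1982, §1.5 Theorem 1.9 (held text chunk p0042)] -/
theorem AbelianVariety.exists_ergodic_mul_right : ∃ Q : A.Points ℂ, Ergodic (fun P : A.Points ℂ ↦ P * Q) μ :=
  (AbelianVariety.ae_ergodic_mul_right A μ hμ).exists

end Monothetic

end Literature.AlgebraicGeometry.HodgeTheory
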